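import Literature.NumberTheory.EllipticCurves.ZpExtensionKroneckerWeberProofs
import Literature.NumberTheory.EllipticCurves.ZpExtensionPadicLogProofs
import HarnessLib

/-!
# `ℚ` has a `ℤ_p`-extension, and exactly one given Kronecker–Weber:
`zpRank_eq_nrComplexPlaces_add_one ℚ p` from the Kronecker–Weber theorem (proofs only)

We discharge the `ℚ`-case of the class-field-theoretic named fact
`Literature.NumberTheory.EllipticCurves.ZpExtension.zpRank_eq_nrComplexPlaces_add_one` (`ZpExtensionRank.lean`: for a number field
of unit rank `0`, `Hom_cont(Γ_K, ℤ_p)` is free of rank `r₂ + 1` with a jointly surjective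
basis; Lang, *Cyclotomic Fields I–II*, Ch. 5 Thm. 5.2 = Washington Thm. 13.4) *relative to the
Kronecker–Weber theorem* (`Literature.NumberTheory.GaloisRepresentations.KroneckerWeber`, named fact):

* existence (unconditional): `ℚ` — indeed any field of characteristic `0` over which all
  cyclotomic polynomials are irreducible — has a surjective continuous character
  `Γ_ℚ →ₜ* ℤ_p`, i.e. a `ℤ_p`-extension (`exists_surjective_continuousMonoidHom`,
  `nonempty_zpExtension_rat`): compose the surjective cyclotomic character
  `χ_p : Γ_ℚ → ℤ_pˣ` (`GaloisRep.cyclotomicCharacter_surjective`) with a non-trivial continuous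
  character `ℤ_pˣ → ℤ_p` (`PadicUnits.exists_continuousMonoidHom_ne_one`, the `γ`-adic
  logarithm) and saturate (`exists_surjective_of_ne_one`);
* uniqueness (from Kronecker–Weber): any character is a `ℤ_p`-multiple of that one, by the
  rank-`≤ 1` statement `dependent_of_kroneckerWeber` (`ZpExtensionKroneckerWeberProofs.lean`).

Hence `zpRank_rat_of_kroneckerWeber : KroneckerWeber → zpRank_eq_nrComplexPlaces_add_one ℚ p`;
in particular the earlier assembly `exists_isAnticyclotomic_of_zpRank_facts`
(`ZpExtensionAnticyclotomicProofs.lean`) applies with its `ℚ`-hypothesis discharged by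
Kronecker–Weber (cf. `exists_isAnticyclotomic_of_kroneckerWeber`).

## References

* [Washington1997] L. C. Washington, *Introduction to Cyclotomic Fields*, 2nd ed. (1997), §13.1
  (p. 264: "it follows from the Kronecker–Weber theorem that `ℚ_∞` is the unique
  `ℤ_p`-extension of `ℚ`"), Thm. 13.4, Thm. 14.1.
* [Lang1990] S. Lang, *Cyclotomic Fields I and II*, GTM 121 (1990), Ch. 5 §5, Thm. 5.2.
* [Greenberg1987] R. Greenberg, *Non-vanishing of certain values of `L`-functions* (1987), §2.
-/

noncomputable section

open Polynomial Field

universe u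

namespace Literature.NumberTheory.EllipticCurves

namespace ZpExtension

section General

variable {K : Type u} [Field K] [CharZero K] {p : ℕ} [Fact p.Prime]

/-- **A `ℤ_p`-extension from the cyclotomic character.**  If all cyclotomic polynomials are
irreducible over `K` (char. `0`), there is a *surjective* continuous character `Γ_K →ₜ* ℤ_p`:
`g ∘ χ_p` is non-trivial for `χ_p` the (surjective) `p`-adic cyclotomic character and
`g : ℤ_pˣ →ₜ* ℤ_p` non-trivial, and a non-trivial character saturates to a surjective one.  Its
kernel cuts out the cyclotomic `ℤ_p`-extension `K_∞ ⊆ K(μ_{p^∞})`.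
Ref: Washington, *Introduction to Cyclotomic Fields*, §13.1 (p. 264); Greenberg, LNM 1716, §1.
[folklore] -/
theorem exists_surjective_continuousMonoidHom
    (hirr : ∀ n : ℕ, 0 < n → Irreducible (cyclotomic n K)) :
    ∃ κ : absoluteGaloisGroup K →ₜ* Multiplicative ℤ_[p], Function.Surjective κ := by
  obtain ⟨g, u, hgu⟩ := PadicUnits.exists_continuousMonoidHom_ne_one (p := p)
  set κ₁ : absoluteGaloisGroup K →ₜ* Multiplicative ℤ_[p] :=
    g.comp (GaloisRepresentations.GaloisRep.cyclotomicCharacter K p) with hκ₁def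
  have hκ₁ : κ₁ ≠ 1 := by
    obtain ⟨σ, hσ⟩ := GaloisRepresentations.GaloisRep.cyclotomicCharacter_surjective K p hirr u
    intro h1
    apply hgu
    have h := DFunLike.congr_fun h1 σ
    rw [← hσ]
    exact h
  obtain ⟨κ, -, hsurj, -⟩ := exists_surjective_of_ne_one κ₁ hκ₁
  exact ⟨κ, hsurj⟩

/-- Under the same hypothesis `K` has a `ℤ_p`-extension (`Literature.ZpExtension K p` is non-empty).
Ref: Washington, *Introduction to Cyclotomic Fields*, §13.1. [folklore] -/
theorem nonempty_zpExtension_of_irreducible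
    (hirr : ∀ n : ℕ, 0 < n → Irreducible (cyclotomic n K)) : Nonempty (ZpExtension K p) := by
  obtain ⟨κ, hκ⟩ := exists_surjective_continuousMonoidHom (K := K) (p := p) hirr
  exact ⟨⟨κ, hκ⟩⟩

end General

section Rat

variable {p : ℕ} [Fact p.Prime]

open NumberField NumberField.InfinitePlace

/-- **`ℚ` has a `ℤ_p`-extension** (unconditionally: cyclotomic polynomials are irreducible over
`ℚ`, `Polynomial.cyclotomic.irreducible_rat`).  Ref: Washington, *Introduction to Cyclotomic
Fields*, §13.1 (the cyclotomic `ℤ_p`-extension `ℚ_∞`). [folklore] -/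
theorem nonempty_zpExtension_rat : Nonempty (ZpExtension ℚ p) :=
  nonempty_zpExtension_of_irreducible fun _ hn => cyclotomic.irreducible_rat hn

/-- **The `ℤ_p`-rank of `ℚ` is `r₂(ℚ) + 1 = 1`, from the Kronecker–Weber theorem**: the
`ℚ`-instance of the named fact `zpRank_eq_nrComplexPlaces_add_one` (Lang, Thm. 5.2; Washington,
Thm. 13.4) holds given `KroneckerWeber`.  The one-element family is a surjective character
`κ : Γ_ℚ →ₜ* ℤ_p` (`exists_surjective_continuousMonoidHom`); every `f : Γ_ℚ →ₜ* ℤ_p` is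
`ℤ_p`-dependent with `κ` (`dependent_of_kroneckerWeber`: `a κ = b f`, `(a, b) ≠ 0`), and
evaluating at `σ₀` with `κ σ₀ = 1` shows `b ≠ 0`, `a = b f(σ₀)`, so `f = f(σ₀) · κ`.
Ref: Washington, *Introduction to Cyclotomic Fields*, §13.1 (p. 264: `ℚ_∞` is the unique
`ℤ_p`-extension of `ℚ`, by Kronecker–Weber) and Thm. 13.4. [folklore] -/
theorem zpRank_rat_of_kroneckerWeber (hKW : GaloisRepresentations.KroneckerWeber) :
    zpRank_eq_nrComplexPlaces_add_one ℚ p := by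
  intro _
  classical
  obtain ⟨κ, hκ⟩ := exists_surjective_continuousMonoidHom (K := ℚ) (p := p)
    fun _ hn => cyclotomic.irreducible_rat hn
  let i₀ : Fin (nrComplexPlaces ℚ + 1) := ⟨0, Nat.succ_pos _⟩
  have hi : ∀ i : Fin (nrComplexPlaces ℚ + 1), i = i₀ := fun i => by
    apply Fin.ext
    have hlt : i.val < nrComplexPlaces ℚ + 1 := i.isLt
    have h0 : nrComplexPlaces ℚ = 0 := IsTotallyReal.nrComplexPlaces_eq_zero ℚ
    show i.val = 0
    omega
  refine ⟨fun _ => κ, fun t => ?_, fun f => ?_⟩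
  · obtain ⟨σ, hσ⟩ := hκ (Multiplicative.ofAdd (t i₀))
    refine ⟨σ, funext fun i => ?_⟩
    show (κ σ).toAdd = t i
    rw [hi i, hσ, toAdd_ofAdd]
  · obtain ⟨a, b, hab, hdep⟩ := dependent_of_kroneckerWeber hKW κ f
    obtain ⟨σ₀, hσ₀⟩ := hκ (Multiplicative.ofAdd 1)
    have hσ₀' : (κ σ₀).toAdd = 1 := by rw [hσ₀, toAdd_ofAdd]
    have hac : a = b * (f σ₀).toAdd := by
      have h := hdep σ₀
      rwa [hσ₀', mul_one] at h
    have hb : b ≠ 0 := by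
      intro hb0
      rw [hb0, zero_mul] at hac
      exact hab.elim (fun ha => ha hac) (fun hb' => hb' hb0)
    refine ⟨fun _ => (f σ₀).toAdd, fun σ => ?_⟩
    rw [Finset.sum_eq_single_of_mem i₀ (Finset.mem_univ _) (fun j _ hj => absurd (hi j) hj)]
    have h := hdep σ
    rw [hac, mul_assoc] at h
    exact (mul_left_cancel₀ hb h).symm

end Rat

end ZpExtension

end Literature.NumberTheory.EllipticCurves
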